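import Summits.CriticalPhenomena.PercolationContinuityZ3.Theorems.PercAnnulusCrossingSlabBoxCrossingPropertyAssembly
import Literature.Probability.Percolation.SlabRSWTheorem314Case2
import HarnessLib

/-!
# RSW3 lane (p2 GEN 40): NTW's Theorem 3.1 at `p_c(S_k)` with CASE 2 OF THEOREM 3.14 DISCHARGED —
# the box-crossing property of the critical slab from the Case-3 input `(H3)` and the upper bound (3.60) only

builds on p205010 (kernel theorem, internal audit signed; external expert review pending) — NOT used in this file.

Cell `prim-rsw3` (LANE 3), seat p2, gen 40.  Support file (`--supports stmt-CriticalPhenomena-4575`); no definitions, no named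
facts, no sorries.  The lead's assembly `Crossing.boxCrossingProperty_slabCritical_of_cases` (GEN 36) reduces NTW's box-crossing
property at `p_c(S_k)` to three inputs: `(H2)` (Case 2 of Thm 3.14: the gluing lemma GL, Thm 3.7 with `S ⊊ R`), `(H3)` (Case 3: the
exploration step and Lemma 3.16), both for an ARBITRARY family of events `𝓑₂ n`, and `(H360)` (the upper bound (3.60)).  This
generation's Literature port (`SlabRSWGluingExt{,B}.lean` = GL in the linear regime for the extended rectangle;
`SlabRSWTheorem314Case2.lean` = NTW's own `𝓑₂` as `NTW17.evCase2 k ρ₂ n` and `(H2)` for it, `NTW17.thm314_hCase2`) discharges `(H2)`: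

* `boxCrossingProperty_slabCritical_of_case3` — for `k ≥ 1`, `ρ₂ ≥ 2`: `(H3)` for `𝓑₂ = NTW17.evCase2 k ρ₂` at `p_c(S_k)` and `(H360)`
  imply `NTW17.BoxCrossingProperty k (p_c(S_k))`.

What remains for NTW's Theorem 3.1 (`NewmanTassionWu2017_thm31`): `(H3)` = NTW (3.47)–(3.52) (exploration of the `X`-cluster and of
`𝒩(Γ̄, ρ₂)`, decoupling, planar separation by `γ ∪ γ'`, GL0 in the rectilinear domain `K_□`, Lemma 3.16) and `(H360)` (Lemma 3.11 /
3.13(i) via Thm 3.8/3.10, Thm 3.17).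

References: C. M. Newman, V. Tassion, W. Wu, *Critical percolation and the minimal spanning tree in slabs*, Comm. Pure Appl. Math. 70
(2017) = arXiv:1512.09107, §3.5 (proof of Theorem 3.14, Case 2), §3.7 [NewmanTassionWu2017].
-/

noncomputable section

namespace Summit.CriticalPhenomena.PercolationContinuityZ3.Theorems.Crossing

open MeasureTheory
open Literature.Probability.Percolation Literature.Probability.LatticeModels
open Literature.Probability.Percolation.NTW17

/-- **NTW's Theorem 3.1 at `p_c(S_k)` from the Case-3 input of Theorem 3.14 and the upper bound (3.60)** (Case 2 discharged by
`NTW17.thm314_hCase2`).  For `k ≥ 1` and a radius `ρ₂ ≥ 2`: if (H3) — for every `x > 0` there are `y > 0`, `n₃` with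
`x ≤ P[𝒜 n ∩ (𝓑₁ n)ᶜ ∩ (𝓑₂ n)ᶜ] ⇒ y ≤ f(14n,13n)` for `n ≥ n₃`, where `𝓑₂ n = NTW17.evCase2 k ρ₂ n` (NTW's `{Y ⟷^R 𝒩(Γ̄, ρ₂)}`),
`𝓑₁ n = {Y ⟷^R X}`, `𝒜 n = {L(S) ⟷^S X} ∩ {B(R) ⟷^R Y}` — holds at `p = p_c(S_k)`, and (H360) `f_{p_c(S_k)}(n,2n) ≤ 1 - c₂` for
`n ≥ 1`, then the box-crossing property holds at `p_c(S_k)`.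
[cite: NewmanTassionWu2017, Theorem 3.1, Theorem 3.14 (Cases 2–3) and §3.7] -/
theorem boxCrossingProperty_slabCritical_of_case3 (k : ℕ) (hk : 1 ≤ k) {ρ₂ : ℕ} (hρ₂ : 2 ≤ ρ₂)
    (hCase3 : ∀ x : ℝ, 0 < x → ∃ y : ℝ, 0 < y ∧ ∃ n₃ : ℕ, ∀ n : ℕ, n₃ ≤ n →
      x ≤ (bondPercolation (slabGraph 3 k) (criticalProbIOf (slabGraph 3 k) (slabOrigin 3 k))).real
        ((slabConn k (boxR 0 (7 * n) 0 (8 * n - 1)) {z | z.1 = 0} (sideSeg (7 * n) 0 (4 * n - 1)) ∩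
            slabConn k (boxR (-(7 * n)) (7 * n) 0 (13 * n - 1)) {z | z.2 = 0} (sideSeg (7 * n) (5 * n) (13 * n - 1))) ∩
          (slabConn k (boxR (-(7 * n)) (7 * n) 0 (13 * n - 1)) (sideSeg (7 * n) (5 * n) (13 * n - 1))
            (sideSeg (7 * n) 0 (4 * n - 1)))ᶜ ∩ (NTW17.evCase2 k ρ₂ n)ᶜ) →
      y ≤ (bondPercolation (slabGraph 3 k) (criticalProbIOf (slabGraph 3 k) (slabOrigin 3 k))).real
        (slabConn k (boxR 0 (14 * n) 0 (13 * n)) {z | z.1 = 0} {z | z.1 = 14 * n}))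
    (h360 : ∃ c₂ : ℝ, 0 < c₂ ∧ ∀ n : ℕ, 1 ≤ n →
      (bondPercolation (slabGraph 3 k) (criticalProbIOf (slabGraph 3 k) (slabOrigin 3 k))).real
        (slabConn k (boxR 0 n 0 (2 * n)) {z | z.1 = 0} {z | z.1 = n}) ≤ 1 - c₂) :
    BoxCrossingProperty k (criticalProbIOf (slabGraph 3 k) (slabOrigin 3 k)) := by
  have hpos : 0 < ((criticalProbIOf (slabGraph 3 k) (slabOrigin 3 k) : unitInterval) : ℝ) := by
    show 0 < criticalProb (slabGraph 3 k) (slabOrigin 3 k)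
    exact (criticalProb_zd_pos 3 (by norm_num)).trans
      (AizenmanGrimmett1991.criticalProb_zd_lt_criticalProb_slab_of_AG (d := 3) le_rfl k)
  have hlt : ((criticalProbIOf (slabGraph 3 k) (slabOrigin 3 k) : unitInterval) : ℝ) < 1 := by
    show criticalProb (slabGraph 3 k) (slabOrigin 3 k) < 1
    exact (Transplant.StairSlabLog.criticalProb_slab_le_half k).trans_lt (by norm_num)
  exact boxCrossingProperty_slabCritical_of_cases k hk (NTW17.evCase2 k ρ₂)
    (thm314_hCase2 hk hρ₂ _ hpos hlt) hCase3 h360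

end Summit.CriticalPhenomena.PercolationContinuityZ3.Theorems.Crossing

end
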